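import Mathlib
import Literature.Combinatorics.Additive.TripleProductProperty

/-!
# `SnSubsetDichotomy.ThresholdSubsetTriples`, line `triality-uniquely-cubing-translate` — the engine's pair criterion
# (helper of crux `stmt-MatrixMultiplication-10882`, lead a1-0)

The exact tester `symtpp.py` behind the line's computed evidence (census c4 §4, kit jobs of the n = 12
KILL test) decides the ℤ/3-symmetric triple product property in conjugation form,
`TPP(S, gSg⁻¹, g²Sg⁻²)`, by the PAIR CRITERION: with `Q = SS⁻¹`, `Q′ = gQg⁻¹`, `Q″ = g²Qg⁻²`,
the TPP fails iff some `x ∈ Q′`, `y ∈ Q″`, not both trivial, have `x·y ∈ Q`.  This file is the Lean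
certificate of that criterion (`stub_pairCriterion`), stated without auxiliary definitions: the TPP of the
conjugate triple holds iff every solution of `(g(bb′⁻¹)g⁻¹)·(g²(cc′⁻¹)g⁻²) = a·a′⁻¹` with
`a, a′, b, b′, c, c′ ∈ S` is trivial.  (The TPP word `s s′⁻¹·t t′⁻¹·u u′⁻¹ = 1` with `t = gbg⁻¹, …` is
`(s s′⁻¹)·X·Y = 1`, i.e. `X·Y = s′ s⁻¹`.)
-/

set_option linter.dupNamespace false

namespace Summit.MatrixMultiplication.MatrixMultiplication.Theorems.ThresholdSubsetTriples

open Literature.Combinatorics.Additive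

/-- **Pair criterion** (registered stub `stub_pairCriterion` of crux `stmt-MatrixMultiplication-10882`):
for a finite set `S` of a group and any `g`, the conjugate triple `(S, gSg⁻¹, g²Sg⁻²)` has the triple
product property iff every solution of `g(bb′⁻¹)g⁻¹ · g²(cc′⁻¹)g⁻² = a a′⁻¹` in `S⁶` is trivial
(`a = a′`, `b = b′`, `c = c′`) — the membership test "`x·y ∈ Q(S)` only for `x = y = 1`" run by the
line's exact tester. -/
theorem stub_pairCriterion {G : Type*} [Group G] [DecidableEq G] (S : Finset G) (g : G) :
    TripleProductProperty S (S.image fun s => g * s * g⁻¹) (S.image fun s => g * g * s * (g * g)⁻¹) ↔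
      ∀ a ∈ S, ∀ a' ∈ S, ∀ b ∈ S, ∀ b' ∈ S, ∀ c ∈ S, ∀ c' ∈ S,
        g * (b * b'⁻¹) * g⁻¹ * (g * g * (c * c'⁻¹) * (g * g)⁻¹) = a * a'⁻¹ → a = a' ∧ b = b' ∧ c = c' := by
  constructor
  · intro h a ha a' ha' b hb b' hb' c hc c' hc' heq
    -- TPP word for s = a', s' = a, t = g b g⁻¹, t' = g b' g⁻¹, u = g² c g⁻², u' = g² c' g⁻²
    have key := h a' ha' a ha (g * b * g⁻¹) (Finset.mem_image_of_mem _ hb) (g * b' * g⁻¹)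
      (Finset.mem_image_of_mem _ hb') (g * g * c * (g * g)⁻¹) (Finset.mem_image_of_mem _ hc)
      (g * g * c' * (g * g)⁻¹) (Finset.mem_image_of_mem _ hc') (by
        calc a' * a⁻¹ * (g * b * g⁻¹ * (g * b' * g⁻¹)⁻¹) * (g * g * c * (g * g)⁻¹ * (g * g * c' * (g * g)⁻¹)⁻¹)
            = a' * a⁻¹ * (g * (b * b'⁻¹) * g⁻¹ * (g * g * (c * c'⁻¹) * (g * g)⁻¹)) := by group
          _ = a' * a⁻¹ * (a * a'⁻¹) := by rw [heq]
          _ = 1 := by group)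
    obtain ⟨h1, h2, h3⟩ := key
    refine ⟨h1.symm, ?_, ?_⟩
    · simpa using h2
    · simpa [mul_assoc] using h3
  · intro h s hs s' hs' t ht t' ht' u hu u' hu' heq
    obtain ⟨b, hb, rfl⟩ := Finset.mem_image.1 ht
    obtain ⟨b', hb', rfl⟩ := Finset.mem_image.1 ht'
    obtain ⟨c, hc, rfl⟩ := Finset.mem_image.1 hu
    obtain ⟨c', hc', rfl⟩ := Finset.mem_image.1 hu'
    have heq' : g * (b * b'⁻¹) * g⁻¹ * (g * g * (c * c'⁻¹) * (g * g)⁻¹) = s' * s⁻¹ := by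
      calc g * (b * b'⁻¹) * g⁻¹ * (g * g * (c * c'⁻¹) * (g * g)⁻¹)
          = (s * s'⁻¹)⁻¹ * (s * s'⁻¹ * (g * b * g⁻¹ * (g * b' * g⁻¹)⁻¹) *
              (g * g * c * (g * g)⁻¹ * (g * g * c' * (g * g)⁻¹)⁻¹)) := by group
        _ = s' * s⁻¹ := by rw [heq]; group
    obtain ⟨h1, h2, h3⟩ := h s' hs' s hs b hb b' hb' c hc c' hc' heq'
    exact ⟨h1.symm, by rw [h2], by rw [h3]⟩

end Summit.MatrixMultiplication.MatrixMultiplication.Theorems.ThresholdSubsetTriples
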